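import Literature.AlgebraicGeometry.Resolution.GeneralizedStabilityRankOne
import Literature.AlgebraicGeometry.Resolution.GeneralizedStabilityFiniteRankLemmas
import Literature.AlgebraicGeometry.Resolution.Henselization
import Literature.AlgebraicGeometry.Resolution.DefectTransport
import Literature.AlgebraicGeometry.Resolution.SeparableClosureValuation
import HarnessLib

/-!
# Generalized stability for `K(t)`: passage to the henselization (Kuhlmann 2010, §5, proof of (R4))

Topic: `Literature/AlgebraicGeometry/Resolution` (valued function fields). Sixth layer of the
decomposition of the named fact `Kuhlmann2010Stability` (`ValuationDefect.lean`) = F.-V. Kuhlmann,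
*Elimination of ramification I: The generalized stability theorem*, Trans. AMS 362 (2010)
5697–5727 = arXiv:1003.5678, **Thm. 1.1**, along the printed proof (§5), below
`GeneralizedStabilityRankOne.lean` (Lemma 5.4: (R3) ⇐ (R4), with (R4) vendored for `F = K(t)` of
rank one over an algebraically closed `K` with a value- resp. residue-transcendental generator).
The proof of (R4) (p. 18 of arXiv:1003.5678) begins

> To complete our proof, we show that (R4) is true. Let `(F|K,v)` satisfy the conditions of
> (R4). Then there is a valuation-transcendental element `x ∈ F` and `F|K(x)` is finite. By
> Corollary 2.13 it suffices to prove (R4) under the additional assumption that `F|K` is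
> rational with a valuation-transcendental generator. In view of Theorem 2.14, we can replace
> `(F,v)` by its henselization. More generally, we will now prove our assertion under the
> assumption that `(F|K,v)` is a henselized inertially generated function field of rank 1 and
> transcendence degree 1 with a valuation-transcendental generator over the algebraically
> closed field `K`. Given an arbitrary finite extension `(E|F,v)`, we have to show that it is
> defectless.

and what follows (pp. 18–20: the ramification group is a `p`-group, so `E.F^r|F^r` is a tower
of normal extensions of degree `p`, realised over a finite `N ⊆ F^r`; Lemma 2.27; Prop. 2.18;
Cor. 4.2 and Prop. 3.1 for the steps of the tower; "henselized inertially generated function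
fields of rank 1 … do not admit proper immediate algebraic extensions"; Lemma 5.5; induction with
Lemma 2.13) proves exactly that assertion. This file renders the first move for the
residue-transcendental case `Kuhlmann2010StabilityRankOneResidueTranscendental`: with the
henselization `K(x)^h ⊆ F̃` of `Henselization.lean` and **Thm. 2.14**
(`Kuhlmann2010DefectlessIffHenselization`: `(F, v)` is a defectless field iff `(F^h, v)` is),
(R4) for `F = K(x)` reduces to the assertion of p. 18 for the henselized rational function field
`K(x)^h` (§2.5: "a henselized function field `(F|K,v)` will be called henselized rational with
generator `x` if `F = K(x)^h`"), which is vendored as a NAMED FACT; the reduction is PROVED.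

## Content

* `IsResidueTranscendental V K x` — §2.5: "`x` residue-transcendental over `K`, i.e., `vx = 0`
  and the residue `x̄` is transcendental over `K̄`", in the ambient rendering of
  `ValuedFunctionFields.lean` (`K ≤ Ω` a subfield of the valued field `(Ω, V)`, `K̄ = resField V K`).
  DEFINITION, with `IsResidueTranscendental.valuation_eq_one` (`vx = 0` is automatic) and
  `IsResidueTranscendental.transcendental` (Lemma 2.5: `x` is transcendental over `K`). PROVED.
* `rankOne_congr` — "rank one" (`F° ≠ F` and the only overrings of `F°` are `F°`, `F`, as in
  `GeneralizedStabilityRankOne.lean`) is invariant under isomorphisms of valued fields. PROVED.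
* `Kuhlmann2010StabilityHenselizedRationalResidueTranscendental` — NAMED FACT: the assertion of
  p. 18 for a henselized rational function field with a residue-transcendental generator: `K`
  an algebraically closed subfield of the algebraically closed valued field `(Ω, V)`, `x ∈ Ω`
  residue-transcendental over `K`, `(K(x), V ∩ K(x))` of rank one ⇒ `(K(x)^h, V ∩ K(x)^h)` is a
  defectless field.
* `Kuhlmann2010StabilityRankOneResidueTranscendental.of_parts :
  Kuhlmann2010DefectlessIffHenselization → Kuhlmann2010StabilityHenselizedRationalResidueTranscendental
  → Kuhlmann2010StabilityRankOneResidueTranscendental` — PROVED: extend `v` from `F = K(t)` to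
  `Ω = F̃` (Chevalley, `exists_valuationSubring_comap_eq`), identify `F` with `K'(x) ⊆ Ω`
  (`K'` the image of `K`, `x` that of `t`), transport rank one and residue-transcendence
  (`residueFieldHom`, `map_residueSubfield`), apply the named fact to `K'(x)^h` and Thm. 2.14 to
  come back to `K'(x)`, and `IsDefectlessField.congr` to come back to `F`.

## Sources

* F.-V. Kuhlmann, *Elimination of ramification I: The generalized stability theorem*, Trans.
  Amer. Math. Soc. 362 (2010) 5697–5727 = arXiv:1003.5678: §2.1 (rank; Lemma 2.1; Lemma 2.5),
  §2.3 (Thm. 2.14), §2.5 (henselized rational / inertially generated function fields, value- and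
  residue-transcendental generators), §4 ((4.3): "`F = K(x)^h(y)` is of rank 1, where `x` is
  residue-transcendental over `K`"; Lemma 4.4: "`F = K(x)^h` where `(K(x),v)` is of rank 1"),
  §5 (Lemma 5.4 (R4) and the proof of (R4), pp. 18–20).

## Rendering notes

* Ambient form (`ValuedFunctionFields.lean`, `Henselization.lean`): one algebraically closed
  valued field `(Ω, V)`; `K ≤ Ω` a subfield which is an algebraically closed field; `K(x)` is
  `(IntermediateField.adjoin K {x}).toSubfield`, valued by `V ∩ K(x)`; its henselization is
  `henselization V K(x)` (the decomposition field of `K(x)^sep|K(x)` with respect to `V`).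
* "of rank 1": the source puts it on `F = K(x)^h(y)` ((4.3)) or on `K(x)` (Lemma 4.4); the two
  agree because `K(x)^h|K(x)` is algebraic (indeed immediate, Lemma 2.2), so that the value
  groups have the same divisible hull (Lemma 2.1) and are simultaneously archimedean (§2.1). The
  named fact carries the hypothesis on `(K(x), V ∩ K(x))`, in the overring form of
  `GeneralizedStabilityRankOne.lean`, which is literally the hypothesis of (R4) being decomposed.
* What is NOT here: the proof of the named fact (pp. 18–20), i.e. ramification theory, Prop. 2.18,
  Lemma 2.27, Cor. 4.2 (§4.2–4.3: Frobenius-closed bases), Prop. 3.1, Lemma 5.5 — the next layers.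
-/

noncomputable section

open IsLocalRing

namespace Literature.AlgebraicGeometry.Resolution

universe u

/-! ### Residue-transcendental elements (§2.5) -/

section ResidueTranscendental

variable {Ω : Type u} [Field Ω] (V : ValuationSubring Ω)

/-- **Residue-transcendental element** (Kuhlmann 2010, §2.5: "a residue-transcendental element
`x ∈ F`, i.e., `vx = 0` and the residue `x̄` is transcendental over `K̄`"), for a subfield `K`
of the ambient valued field `(Ω, V)`: `x ∈ V` and the residue of `x` is transcendental over the
residue field `K̄ = resField V K` of `(K, V ∩ K)` (then `vx = 0`, `valuation_eq_one`).
[cite: Kuhlmann2010, Section 2.5] -/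
def IsResidueTranscendental (K : Subfield Ω) (x : Ω) : Prop :=
  ∃ hx : x ∈ V, Transcendental (resField V K) (residue V ⟨x, hx⟩)

variable {V}

/-- A residue-transcendental element lies in the valuation ring. [cite: Kuhlmann2010, Section 2.5] -/
theorem IsResidueTranscendental.mem {K : Subfield Ω} {x : Ω} (h : IsResidueTranscendental V K x) :
    x ∈ V :=
  h.1

/-- A residue-transcendental element has value `vx = 0` (multiplicatively: `1`): otherwise its
residue is `0`, which is algebraic. [cite: Kuhlmann2010, Section 2.5] -/
theorem IsResidueTranscendental.valuation_eq_one {K : Subfield Ω} {x : Ω}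
    (h : IsResidueTranscendental V K x) : V.valuation x = 1 := by
  obtain ⟨hx, htr⟩ := h
  rcases V.valuation_lt_one_or_eq_one ⟨x, hx⟩ with hlt | h1
  · exfalso
    have h0 : residue V ⟨x, hx⟩ = 0 :=
      (residue_eq_zero_iff _).mpr ((V.valuation_lt_one_iff _).mpr hlt)
    apply htr
    rw [h0]
    exact isAlgebraic_zero
  · exact h1

/-- **Kuhlmann 2010, Lemma 2.5 for one residue-transcendental element**: a residue-transcendental
`x` is transcendental over `K` ("In both cases, `x` is transcendental over `K` by Lemma 2.5"):
a relation `P(x) = 0` over `K` makes the residue `x̄` algebraic over `K̄`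
(`isAlgebraic_residue_of_eval_eq_zero`). PROVED. [cite: Kuhlmann2010, Lemma 2.5 and Section 2.5] -/
theorem IsResidueTranscendental.transcendental {K : Subfield Ω} {x : Ω}
    (h : IsResidueTranscendental V K x) : Transcendental K x := by
  obtain ⟨hx, htr⟩ := h
  rintro ⟨p, hp0, hpx⟩
  apply htr
  refine isAlgebraic_residue_of_eval_eq_zero V K (P := p.map (algebraMap K Ω)) ?_ ?_ hx ?_
  · exact (Polynomial.map_ne_zero_iff (algebraMap K Ω).injective).mpr hp0
  · intro k
    rw [Polynomial.coeff_map]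
    exact (p.coeff k).2
  · rwa [Polynomial.eval_map, ← Polynomial.aeval_def]

end ResidueTranscendental

/-! ### Rank one under isomorphisms of valued fields -/

section RankOne

variable {F₁ F₂ : Type u} [Field F₁] [Field F₂]

/-- **Rank one is invariant under isomorphisms of valued fields**: for `ψ : F₁ ≃ F₂` with
`O₁ = ψ⁻¹(O₂)`, if `O₁ ≠ F₁` and the only overrings of `O₁` are `O₁` and `F₁`, then the same
holds for `O₂` (overrings correspond under `ψ`). [folklore] -/
theorem rankOne_congr (ψ : F₁ ≃+* F₂) {O₁ : ValuationSubring F₁} {O₂ : ValuationSubring F₂}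
    (hO : O₁ = O₂.comap ψ.toRingHom) (h₁ : O₁ ≠ ⊤)
    (h₂ : ∀ S : ValuationSubring F₁, O₁ ≤ S → S = O₁ ∨ S = ⊤) :
    O₂ ≠ ⊤ ∧ ∀ S : ValuationSubring F₂, O₂ ≤ S → S = O₂ ∨ S = ⊤ := by
  subst hO
  refine ⟨fun htop => h₁ ?_, fun S hS => ?_⟩
  · rw [htop]
    ext y
    simp [ValuationSubring.mem_comap, ValuationSubring.mem_top]
  · rcases h₂ (S.comap ψ.toRingHom) (fun y hy => hS hy) with h | h
    · left
      rw [← comap_comap_ringEquiv_symm ψ S, h, comap_comap_ringEquiv_symm]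
    · right
      rw [← comap_comap_ringEquiv_symm ψ S, h]
      ext y
      simp [ValuationSubring.mem_comap, ValuationSubring.mem_top]

end RankOne

/-! ### The assertion of p. 18 for henselized rational function fields (named fact) -/

/-- NAMED FACT — **Kuhlmann 2010, §5, proof of (R4): a henselized rational function field of
rank one with a residue-transcendental generator over an algebraically closed field is a
defectless field.** P. 18: "In view of Theorem 2.14, we can replace `(F,v)` by its
henselization. More generally, we will now prove our assertion under the assumption that
`(F|K,v)` is a henselized inertially generated function field of rank 1 and transcendence degree
1 with a valuation-transcendental generator over the algebraically closed field `K`. Given an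
arbitrary finite extension `(E|F,v)`, we have to show that it is defectless" — proved on
pp. 18–20 (ramification theory: `E.F^r|F^r` is a tower of normal extensions of degree `p`,
realised over a finite `N ⊆ F^r`; Lemma 2.27; Prop. 2.18; Cor. 4.2 resp. Prop. 3.1 for each step;
Lemma 5.5; induction with Lemma 2.13). Vendored for the henselized RATIONAL function field
`F = K(x)^h` (§2.5: "henselized rational with generator `x` if `F = K(x)^h`"; it is henselized
inertially generated with generator `x`, being a trivial unramified extension of itself) with a
residue-transcendental generator `x` (§2.5), in the ambient rendering of `Henselization.lean`:
`(Ω, V)` an algebraically closed valued field, `K ≤ Ω` a subfield which is an algebraically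
closed field (valued by `V ∩ K`), `x ∈ Ω` residue-transcendental over `K`, `K(x) ≤ Ω` valued by
`V ∩ K(x)` and of rank one — `V ∩ K(x) ≠ K(x)` and its only overrings are itself and `K(x)`
(§2.1; the source's "of rank 1" for `F = K(x)^h`, (4.3), equivalently for `K(x)`, Lemma 4.4,
`K(x)^h|K(x)` being algebraic) —; then the henselization `(K(x)^h, V ∩ K(x)^h)`
(`henselization V K(x)`, the decomposition field of `(K(x)^sep|K(x), V)`) is a defectless field.
(In residue characteristic `0` this is an instance of Cor. 2.12, "Every valued field `(K,v)`
with `char Kv = 0` is a defectless field"; the source assumes `char Kv = p > 0` from §1 on and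
proves the assertion on pp. 18–20.) Its proof needs the ramification theory of valued fields,
Prop. 2.18 ([K6]) and the normal forms of §4 (Frobenius-closed bases, [K5]), none of which is in
Mathlib. Users take
`(h : Kuhlmann2010StabilityHenselizedRationalResidueTranscendental)`.
[cite: Kuhlmann2010, Section 5, proof of (R4) (pp. 18–20 of arXiv:1003.5678)] -/
def Kuhlmann2010StabilityHenselizedRationalResidueTranscendental : Prop :=
  ∀ (Ω : Type u) [Field Ω] [IsAlgClosed Ω] (V : ValuationSubring Ω) (K : Subfield Ω) (x : Ω)
    (Kx : Subfield Ω), IsAlgClosed K → IsResidueTranscendental V K x →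
    Kx = (IntermediateField.adjoin K ({x} : Set Ω)).toSubfield →
    V.comap (algebraMap Kx Ω) ≠ ⊤ →
    (∀ S : ValuationSubring Kx, V.comap (algebraMap Kx Ω) ≤ S →
      S = V.comap (algebraMap Kx Ω) ∨ S = ⊤) →
    IsDefectlessField (henselization V Kx) (V.comap (algebraMap (henselization V Kx) Ω))

/-! ### (R4) for `K(t)`, `t` residue-transcendental, from Thm. 2.14 and the named fact -/

/-- **Kuhlmann 2010, (R4) for `F = K(t)` of rank one with a residue-transcendental generator over
an algebraically closed `K`, from Thm. 2.14 and the assertion of p. 18 for `K(t)^h`** ("In view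
of Theorem 2.14, we can replace `(F,v)` by its henselization"). PROVED: extend `v` from `F` to
the algebraic closure `Ω = F̃` (Chevalley, `exists_valuationSubring_comap_eq`); the image
`E ⊆ Ω` of `F` is `K'(x)` for the image `K'` of `K` (algebraically closed) and `x` of `t`;
`x` is residue-transcendental over `K'` (the residue map of `F° = V ∩ F` embeds into that of
`V`, carrying `Kv ⊆ Fv` onto `K'v̄ ⊆ Ωv̄`: `residueFieldHom`, `map_residueSubfield`) and
`(E, V ∩ E)` has rank one with `(F, F°)` (`rankOne_congr`); the named fact makes
`(E^h, V ∩ E^h)` a defectless field, Thm. 2.14 (`Kuhlmann2010DefectlessIffHenselization`) makes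
`(E, V ∩ E)` one, and `IsDefectlessField.congr` transports this back to `(F, F°)`.
[cite: Kuhlmann2010, Section 5, Lemma 5.4 (R4) and proof of (R4) (p. 18)] -/
theorem Kuhlmann2010StabilityRankOneResidueTranscendental.of_parts
    (hA : Kuhlmann2010DefectlessIffHenselization.{u})
    (hB : Kuhlmann2010StabilityHenselizedRationalResidueTranscendental.{u}) :
    Kuhlmann2010StabilityRankOneResidueTranscendental.{u} := by
  intro K F _ _ _ _ O t hO hrk htr hgen
  classical
  -- fix an extension `V` of `v` to the algebraic closure `F̃`
  obtain ⟨V, hV⟩ := exists_valuationSubring_comap_eq (Ω := AlgebraicClosure F) O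
  subst hV
  -- the image `E ⊆ F̃` of `F` and `ψ : F ≃ E`
  let ψ : F ≃+* (algebraMap F (AlgebraicClosure F)).fieldRange :=
    RingEquiv.ofBijective (algebraMap F (AlgebraicClosure F)).rangeRestrictField
      (algebraMap F (AlgebraicClosure F)).rangeRestrictField_bijective
  have hOψ : V.comap (algebraMap F (AlgebraicClosure F)) =
      (V.comap (algebraMap (algebraMap F (AlgebraicClosure F)).fieldRange
        (AlgebraicClosure F))).comap ψ.toRingHom := by
    ext y
    simp only [ValuationSubring.mem_comap]
    exact Iff.rfl
  -- the image `K'` of `K`, an algebraically closed subfield of `F̃`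
  have hK'ac : IsAlgClosed (algebraMap K (AlgebraicClosure F)).fieldRange :=
    IsAlgClosed.of_ringEquiv K _
      (RingEquiv.ofBijective (algebraMap K (AlgebraicClosure F)).rangeRestrictField
        (algebraMap K (AlgebraicClosure F)).rangeRestrictField_bijective)
  -- `x`, the image of `t`, is residue-transcendental over `K'`
  have hxV : algebraMap F (AlgebraicClosure F) t ∈ V := t.2
  have hrt : IsResidueTranscendental V (algebraMap K (AlgebraicClosure F)).fieldRange
      (algebraMap F (AlgebraicClosure F) t) := by
    refine ⟨hxV, ?_⟩
    -- the residue map of `F° → V` and its restriction `Kv ⊆ Fv → K'v̄ ⊆ F̃v̄`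
    let ρ : ResidueField (V.comap (algebraMap F (AlgebraicClosure F))) →+*
        ResidueField V := residueFieldHom F V
    have hmap : (residueSubfield K (V.comap (algebraMap F (AlgebraicClosure F)))).map ρ =
        residueSubfield K V :=
      map_residueSubfield K F V
    let f : residueSubfield K (V.comap (algebraMap F (AlgebraicClosure F))) →+*
        residueSubfield K V :=
      ρ.restrict _ _ fun r hr => by
        rw [← hmap]
        exact Subfield.mem_map.mpr ⟨r, hr, rfl⟩
    have hf : Function.Surjective f := by
      rintro ⟨r', hr'⟩
      rw [← hmap] at hr'
      obtain ⟨r, hr, rfl⟩ := Subfield.mem_map.mp hr'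
      exact ⟨⟨r, hr⟩, rfl⟩
    have hcomp : (algebraMap (residueSubfield K V) (ResidueField V)).comp f =
        ρ.comp (algebraMap (residueSubfield K (V.comap (algebraMap F (AlgebraicClosure F))))
          (ResidueField (V.comap (algebraMap F (AlgebraicClosure F))))) :=
      RingHom.ext fun _ => rfl
    have h1 : Transcendental (residueSubfield K V) (ρ (residue _ t)) :=
      htr.ringHom_of_comp_eq f ρ hf ρ.injective hcomp
    have h2 : ρ (residue _ t) = residue V ⟨algebraMap F (AlgebraicClosure F) t, hxV⟩ := by
      change residueFieldHom F V (residue _ t) = _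
      rw [residueFieldHom_residue]
      rfl
    rw [h2] at h1
    -- `Kv ⊆ F̃v̄` is the residue field of the subfield `K'`
    have key : ∀ S : Subfield (ResidueField V),
        S = resField V (algebraMap K (AlgebraicClosure F)).fieldRange →
        Transcendental S (residue V ⟨algebraMap F (AlgebraicClosure F) t, hxV⟩) →
        Transcendental (resField V (algebraMap K (AlgebraicClosure F)).fieldRange)
          (residue V ⟨algebraMap F (AlgebraicClosure F) t, hxV⟩) := by
      rintro S rfl h
      exact h
    exact key _ (residueSubfield_eq_resField V) h1
  -- `E = K'(x)`
  have hEeq : (algebraMap F (AlgebraicClosure F)).fieldRange =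
      (IntermediateField.adjoin (algebraMap K (AlgebraicClosure F)).fieldRange
        ({algebraMap F (AlgebraicClosure F) t} : Set (AlgebraicClosure F))).toSubfield := by
    have h1 : (IsScalarTower.toAlgHom K F (AlgebraicClosure F)).fieldRange =
        IntermediateField.adjoin K ({algebraMap F (AlgebraicClosure F) t} : Set (AlgebraicClosure F)) := by
      rw [AlgHom.fieldRange_eq_map, ← hgen, IntermediateField.adjoin_map, Set.image_singleton]
      rfl
    have h2 : (algebraMap F (AlgebraicClosure F)).fieldRange =
        (IsScalarTower.toAlgHom K F (AlgebraicClosure F)).fieldRange.toSubfield := by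
      ext y
      simp only [RingHom.mem_fieldRange, IntermediateField.mem_toSubfield, AlgHom.mem_fieldRange]
      exact Iff.rfl
    rw [h2, h1, IntermediateField.adjoin_toSubfield, IntermediateField.adjoin_toSubfield,
      range_algebraMap_subfield, RingHom.coe_fieldRange]
  -- `(E, V ∩ E)` has rank one
  obtain ⟨hE1, hE2⟩ := rankOne_congr ψ hOψ hO hrk
  -- the named fact for `E^h = K'(x)^h`, and Thm. 2.14
  have hdefE : IsDefectlessField (algebraMap F (AlgebraicClosure F)).fieldRange
      (V.comap (algebraMap (algebraMap F (AlgebraicClosure F)).fieldRange (AlgebraicClosure F))) :=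
    (hA (AlgebraicClosure F) V _).mpr (hB (AlgebraicClosure F) V _ _ _ hK'ac hrt hEeq hE1 hE2)
  -- back to `(F, F°)` along `ψ`
  refine IsDefectlessField.congr ψ.symm ?_ hdefE
  rw [hOψ]
  exact (comap_comap_ringEquiv_symm ψ _).symm

end Literature.AlgebraicGeometry.Resolution
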